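import Summits.QuantumFields.YangMills.Theorems.BalabanUVNodesN08AlphaEq324RowClassSocketEndUnitRange
import Literature.MathematicalPhysics.QuantumFieldTheory.Balaban1983to89.B10Eq55GaussianStepBallCutoff

/-!
# Route «BalabanUVNodes», Track-A DAG node N08 = [Balaban1985UV3] Thm 1 p. 257 ∕ Thm 2 p. 272 — THE (α)-SOCKET WITH PRINT's CUT-OFF SHAPE AS AN IDENTITY:
# the (3.24) row `h324` at EVERY run step for an a.e. presentation of the step block by cell lit-balaban's `dμ_{C^{(k)}} = gaussMeasure μ Δ` whose small-field cut-off is,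
# in torus-labelled coordinates, the PRODUCT OF EUCLIDEAN BALLS per bond — [Balaban1985UV3] (51) p.268 ∕ (58) p.270 `χ = Π_b χ(|A(b)| ≤ p(g_k))`, `|·|` the Hilbert–Schmidt norm on `𝔤`
# (part 13 of the class socket; CHECK D closed in print's own shape)

Cell `pub-ymgap`, seat `pub-ymgap-dag-n08-w4` gen 6 (CLAIM-8 ∕ INTENT-8).  `bears_on: R4∕N08`; filed `--supports stmt-QuantumFields-27364` (K1⁹, helper).  THEOREMS ONLY
(def-free, sorry-free, standard axioms); seat n08-b's `B10Eq55GaussianStepBallCutoff.eq324_gaussMeasure_torus_ballCutoff_on_unit` ∕ `preimage_ballBox_eq` (gen 15, over their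
`…ClassSandwichedCutoff` p649550 and `B10Eq55GaussianStepPresentation` p647337), their `…ClassSandwichedCutoff.measurableSet_ballProduct`, part 2's
`…ClassSocketAE.cumulantOf_moments_map_eq_of_ae`, gen 2's `…CumLetterModel.setIntegral_exp_map_eq ∕ budget_le_vol ∕ gk_rpow_six_add`, gen 0's `…RowSocket.eq324_mono` and seat
n08-d's `B1Eq324CumulantTaylor.eq324_iff_abs_log_sub_le` consumed BY NAME.

WHY.  Part 11 (`…ClassSocketEndSandwiched`, p650319) and part 12 read the cut-off through a SANDWICH between two coordinate boxes; seat n08-b's gen-15 Literature files push the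
sandwich down: `…ClassSandwichedCutoff` proves (3.24) for every cut-off squeezed between the boxes and instantiates it at the product of Euclidean balls over the fibres of a
grouping `π : β → B` of the coordinates (fibre size `≤ n` — the `d(𝔤)` real components of one bond variable `A(b) ∈ 𝔤`), and `B10Eq55GaussianStepBallCutoff` states it for
lit-balaban's `gaussMeasure μ Δ` presented by the class field.  So the socket can again ask for an a.e. IDENTITY — now in PRINT's shape:
`Ψ⁻¹'(𝔖 k).box h =ᵐ {A | ∀ bonds c₀, √(Σ_{π b = c₀} (bs.equivFun A b)²) ≤ p(g_k)}` — and conclude `h324` at the free letter, every run step.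
* §1 ★ `eq324_box_of_presentation_ae` — part 2's one-instance transport with an ARBITRARY pulled-back cut-off set `s` (`Φ⁻¹'box =ᵐ[μ] s`) in place of `smallFieldSet I b`.
* §2 ★★★★ `exists_threshold_h324Row_freeLetter_of_gaussMeasureTorusPresentation_ballCutoff_allSteps_ae` — scalars `(d_T ≥ 1, m, n ≥ 1, γ_A, K_T, κ_T, D, ϰ, p₀, σ, c₀)` ⟹
  `∃ b₁ ∀ b₀ > b₁ ∃ C ≥ 0 ∀ S ∀ k ≤ K ∀ v (C·v ≤ Ca + Cc)`, ∀ member data (torus-labelled variables `β`, space `Sp` with a Lebesgue measure, basis `bs`, form `Δ` with matrix rows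
  in the torus metric) ⟹ `∃ (Λ, e)` (BEFORE the tower data), ∀ `𝔖`, grouping `π : β → B` (fibres `≤ n`), measurable `Ψ h U : Sp → Fl` with `(𝔖 k).μ = (gaussMeasure μ Δ).map (Ψ h U)`,
  the BALL-PRODUCT IDENTITY above, `𝒱 ∘ Ψ =ᵐ H`, Hamiltonian letters `H (bs.equivFun.symm (z ∘ e)) = H^{aw}_{Jw} z` on the bent window (`Jw ⊆ Λ`, `sup|coeff| ≤ c₀ g_k^σ`),
  `|β| ≤ v·|T₁^{(k)}|` ⟹ `h324`.
HONEST SCOPE.  A composition by name; lit-balaban's `(Sp, μ, Δ, bs)` are ABSTRACT and the grouping `π`, the member rows, `Ψ`, the identity, the Hamiltonian letters, the window and the budget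
are HYPOTHESES — the pins «`(𝔖 k).μ` is that measure», «`box h` is that ball product in an HS-orthonormal basis of `𝔤` per bond» are THE IDENT (NODE 00; see this seat's CHECK E),
NOT made ∕ commissioned ∕ claimed; nothing of [Balaban1985UV3] ∕ [BenfattoEtAl1978] ∕ [Balaban1985BackgroundPropagators] asserted or discharged; `PrintedUV3V` NOT proved; N08 NOT
discharged; count-neutral; one finite 𝕋⁴ programme at fixed ε — R4 closes the conditional finite-𝕋⁴ rung `BalabanLadder.UV` only; nothing continuum ∕ ℝ⁴ ∕ OS ∕ mass gap ∕ Clay.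
-/

noncomputable section

namespace Summit.QuantumFields.YangMills.Theorems.BalabanUVNodesN08AlphaEq324RowClassSocketEndBallCutoff

open MeasureTheory
open scoped BigOperators Nat Matrix
open Literature.MathematicalPhysics.QuantumFieldTheory (gaussianFieldOfKernel)
open Literature.MathematicalPhysics.QuantumFieldTheory.Balaban1983to89
open Literature.MathematicalPhysics.QuantumFieldTheory.Balaban1983to89.B1Sect3Statements (Eq324)
open Literature.MathematicalPhysics.QuantumFieldTheory.Balaban1983to89.B1Eq324BenfattoLemma (Coef hamiltonian coefSup truncatedExp cumulantSum)
open Literature.MathematicalPhysics.QuantumFieldTheory.Balaban1983to89.B1Eq324CumulantTaylor (eq324_iff_abs_log_sub_le)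
open Literature.MathematicalPhysics.QuantumFieldTheory.Balaban1983to89.B1Eq324BenfattoClassPresentation (measurable_restrictAlong)
open Literature.MathematicalPhysics.QuantumFieldTheory.Balaban1983to89.B1Eq324BenfattoClassSandwichedCutoff (measurableSet_ballProduct)
open Literature.MathematicalPhysics.QuantumFieldTheory.Balaban1983to89.B10Eq55GaussianStep (gaussMeasure)
open Literature.MathematicalPhysics.QuantumFieldTheory.Balaban1983to89.B10Eq55GaussianStepBallCutoff (eq324_gaussMeasure_torus_ballCutoff_on_unit preimage_ballBox_eq)
open Literature.MathematicalPhysics.QuantumFieldTheory.Balaban1985CMP102.Setting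
open Summit.QuantumFields.Balaban3D.Carriers
open Summit.QuantumFields.Balaban3D.Proofs.ScalesArithmetic (gk_pos gk_le_one g0sq_pos L_pos sites_nonneg)
open Summit.QuantumFields.Balaban3D.Proofs.Primitives (AlphaConsts)
open Summit.QuantumFields.Balaban3D.Proofs.GroupModelLieC (lieC)
open Summit.QuantumFields.YangMills.Theorems.BalabanUVNodesN08AlphaEq324RowSocket (eq324_mono)
open Summit.QuantumFields.YangMills.Theorems.BalabanUVNodesN08AlphaEq324RowCumLetterModel (budget_le_vol gk_rpow_six_add setIntegral_exp_map_eq)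
open Summit.QuantumFields.YangMills.Theorems.BalabanUVNodesN08AlphaEq324RowClassSocketAE (cumulantOf_moments_map_eq_of_ae)
open Literature.Probability.LatticeModels (cumulantOf)

/-! ## §1 The one-instance transport with an arbitrary pulled-back cut-off set -/

section Transport

variable {d : ℕ} {Fl : Type*} [MeasurableSpace Fl]

/-- ★ Part 2's transport, the cut-off pulling back to an ARBITRARY set `s`: a block `(Fl, μ𝔖, box, V)` presented by `μ` (`μ𝔖 = μ.map Φ`, `Φ⁻¹'box =ᵐ[μ] s`, `V ∘ Φ =ᵐ[μ] H`)
inherits `Eq324` from `(∫_s e^H dμ, ℰ_μᵀ(H;·))`, same constants. [cite: Balaban1985UV3, (58) p.270; Balaban1982Higgs1, (3.24) p.616; BenfattoEtAl1978, (2.7) p.147 (bookkeeping)] -/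
theorem eq324_box_of_presentation_ae {μ𝔖 : Measure Fl} {box : Set Fl} {V : Fl → ℝ}
    (μ : Measure ((Fin d → ℤ) → ℝ)) {Φ : ((Fin d → ℤ) → ℝ) → Fl} (hΦ : Measurable Φ) (hμ : μ𝔖 = μ.map Φ) (hboxm : MeasurableSet box) (hVm : Measurable V)
    {s : Set ((Fin d → ℤ) → ℝ)} (hbox : Φ ⁻¹' box =ᵐ[μ] s) {H : ((Fin d → ℤ) → ℝ) → ℝ} (hV : (fun z => V (Φ z)) =ᵐ[μ] H)
    {nbar : ℕ} {C sc κ vol : ℝ} (h : Eq324 (∫ z in s, Real.exp (H z) ∂μ) (fun n => truncatedExp μ H n) nbar C sc κ vol) :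
    Eq324 (∫ ω in box, Real.exp (V ω) ∂μ𝔖) (fun n => cumulantOf (fun m => ∫ ω, V ω ^ m ∂μ𝔖) n) nbar C sc κ vol := by
  subst hμ
  have hint : ∫ ω in box, Real.exp (V ω) ∂(μ.map Φ) = ∫ z in s, Real.exp (H z) ∂μ := by
    rw [setIntegral_exp_map_eq μ hΦ hboxm hVm, setIntegral_congr_set hbox]
    exact integral_congr_ae (ae_restrict_of_ae (hV.mono fun z hz => by simp only [← hz]))
  have hc : (fun n => cumulantOf (fun m => ∫ ω, V ω ^ m ∂(μ.map Φ)) n) = fun n => truncatedExp μ H n :=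
    funext fun n => cumulantOf_moments_map_eq_of_ae μ hΦ hVm hV n
  rw [hint, hc]
  exact h

end Transport

/-! ## §2 The END with print's cut-off shape -/

variable {L : ℕ} {G : Type} [GaugeGroup G] [MeasurableSpace G] [HaarData G] (𝔊 : GroupModel G) (𝔠 : AlphaConsts L 𝔊.N)

/-- ★★★★ **ROW `h324` AT EVERY RUN STEP FROM A PRESENTATION BY LIT-BALABAN's `dμ_{C^{(k)}} = gaussMeasure μ Δ` WHOSE CUT-OFF IS PRINT's PRODUCT OF BALLS PER BOND** (statement in
the module docstring).  `b₁` depends on `(d_T, m, n, γ_A, K_T, κ_T, D, ϰ, p₀, σ, c₀, n̄, κ₀)` only; for `b₀ > b₁` the constant `C` on those and `b₀`; the member data are per step, `(Λ, e)`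
are returned before the tower data, and `Ψ`, the grouping `π`, the identity, the Hamiltonian letters may depend on `(h, U)`.
[cite: Balaban1985UV3, (51) p.268 + (55) p.269 + (58) p.270 + p.271; Balaban1985BackgroundPropagators, p.390 «Hilbert–Schmidt norm» + (3.155)–(3.158) pp.427–428;
Balaban1982Higgs1, (3.24) p.616; BenfattoEtAl1978, Lemma p.152 (class form; ours)] -/
theorem exists_threshold_h324Row_freeLetter_of_gaussMeasureTorusPresentation_ballCutoff_allSteps_ae {dT : ℕ} (hdT : 0 < dT) (m n : ℕ) (hn : 1 ≤ n)
    {γA KT κT : ℝ} (hγA0 : 0 < γA) (hKT : 0 ≤ KT) (hκT : 0 < κT)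
    (D : ℕ) {ϰ : ℝ} (hϰ : 0 < ϰ) {p₀ σ c₀ : ℝ} (hp₀ : 2 / 3 < p₀) (hσ : 0 < σ) (hc₀ : 0 ≤ c₀) (hκσ : 6 + 2 * 𝔠.κ₀ < σ * (𝔠.nbar + 1)) :
    ∃ b₁ : ℝ, ∀ b₀ : ℝ, b₁ < b₀ → ∃ C : ℝ, 0 ≤ C ∧
      ∀ (S : Scales L) (k : ℕ), k ≤ S.K → ∀ (v : ℝ), C * v ≤ 𝔠.Ca + 𝔠.Cc →
        ∀ {N : ℕ} [NeZero N] {β : Type} [Fintype β] [DecidableEq β] [Nonempty β]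
          (site : β → Fin dT → ZMod N) (lab : β → Fin m), (Function.Injective fun b => (site b, lab b)) →
        ∀ {Sp : Type} [NormedAddCommGroup Sp] [NormedSpace ℝ Sp] [MeasurableSpace Sp] [BorelSpace Sp]
          (μS : Measure Sp) [μS.IsAddHaarMeasure] (bs : Module.Basis β ℝ Sp) (Δ : Sp →ₗ[ℝ] Sp →ₗ[ℝ] ℝ) {ρ : β → β → ℝ},
          (∀ b b', LinearMap.toMatrix₂ bs bs Δ b b' = LinearMap.toMatrix₂ bs bs Δ b' b) →
          (∀ x : β → ℝ, γA * ∑ b, x b ^ 2 ≤ ∑ b, ∑ b', LinearMap.toMatrix₂ bs bs Δ b b' * x b * x b') →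
          (∀ b b', |LinearMap.toMatrix₂ bs bs Δ b b'| ≤ KT * Real.exp (-(κT * ρ b b'))) →
          (∀ b b' i, (|((site b i - site b' i).valMinAbs : ℤ)| : ℝ) ≤ ρ b b') →
        ∃ (Λ : Finset (Fin (dT + dT + 1) → ℤ)) (e : β ≃ ↥Λ),
        ∀ (𝔖 : ∀ k, StepSeries S G ↥(lieC 𝔊) (nblkOf S 𝔠.lane.carrier k) k) {B : Type} [Fintype B] [DecidableEq B] (π : β → B),
          (∀ c₀ : B, (Finset.univ.filter (fun b => π b = c₀)).card ≤ n) →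
        ∀ (Ψ : Hist S.P (k + 1) → GaugeField S.P (k + 1) G → Sp → (𝔖 k).Fl) (H : Hist S.P (k + 1) → GaugeField S.P (k + 1) G → Sp → ℝ)
          (s : ℕ) (Jw : Hist S.P (k + 1) → GaugeField S.P (k + 1) G → Finset (Fin (dT + dT + 1) → ℤ))
          (aw : Hist S.P (k + 1) → GaugeField S.P (k + 1) G → Coef (dT + dT + 1)),
          (∀ h U, Measurable (Ψ h U)) → (∀ h U, (𝔖 k).μ = (gaussMeasure μS Δ).map (Ψ h U)) →
          (∀ h, MeasurableSet ((𝔖 k).box h)) → (∀ h U, Measurable ((𝔖 k).𝒱 h U)) →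
          -- PRINT's CUT-OFF: the product over the bonds `c₀` of the Euclidean balls of radius `p(g_k)` in the `d(𝔤)` coordinates of `A(c₀)`
          (∀ h U, Ψ h U ⁻¹' (𝔖 k).box h =ᵐ[gaussMeasure μS Δ]
            {A : Sp | ∀ c₀ : B, Real.sqrt (∑ b ∈ Finset.univ.filter (fun b => π b = c₀), bs.equivFun A b ^ 2) ≤ B10.pFun b₀ p₀ (S.gk k)}) →
          (∀ h U, (fun A => (𝔖 k).𝒱 h U (Ψ h U A)) =ᵐ[gaussMeasure μS Δ] H h U) →
          (∀ h U (z : (Fin (dT + dT + 1) → ℤ) → ℝ), H h U (bs.equivFun.symm fun b => z ((e b : ↥Λ) : Fin (dT + dT + 1) → ℤ)) =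
            hamiltonian s D ϰ (aw h U) (Jw h U) z) →
          (∀ h U, Jw h U ⊆ Λ) → (∀ h U, coefSup s D (aw h U) (Jw h U) ≤ c₀ * S.gk k ^ σ) → ((Fintype.card β : ℝ) ≤ v * S.sites k) →
          ∀ h (U : GaugeField S.P (k + 1) G),
            Eq324 (∫ ω in (𝔖 k).box h, Real.exp ((𝔖 k).𝒱 h U ω) ∂(𝔖 k).μ)
              (fun n' => cumulantOf (fun m' => ∫ ω, (𝔖 k).𝒱 h U ω ^ m' ∂(𝔖 k).μ) n') 𝔠.nbar (𝔠.Ca + 𝔠.Cc)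
              ((L : ℝ) ^ k * S.g0sq) (3 + 𝔠.κ₀) (S.sites k) := by
  obtain ⟨b₁, hb₁⟩ := eq324_gaussMeasure_torus_ballCutoff_on_unit (d := dT) hdT m n hn hγA0 hKT hκT 𝔠.nbar D hϰ hp₀ hσ hc₀
    (κ := 6 + 2 * 𝔠.κ₀) (by linarith [𝔠.κ₀_pos]) hκσ
  refine ⟨b₁, fun b₀ hb => ?_⟩
  obtain ⟨C, hC, hcap⟩ := hb₁ b₀ hb
  refine ⟨C, hC, ?_⟩
  intro S k hk v hCv N _ β _ _ _ site lab hinj Sp _ _ _ _ μS _ bs Δ ρ hMs hγ hdec hρ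
  obtain ⟨Λ, e, hgm, hpair⟩ := hcap (S.gk k) (gk_pos S k) (gk_le_one S S.gK_le_one k hk) site lab hinj μS bs Δ hMs hγ hdec hρ
  refine ⟨Λ, e, ?_⟩
  intro 𝔖 B _ _ π hπ Ψ H s Jw aw hΨ hμ hboxm hVm hbox hV hH hJΛ hA hβv h U
  have hsym : Measurable (⇑bs.equivFun.symm : (β → ℝ) → Sp) := bs.equivFunL.symm.continuous.measurable
  have hq : Measurable fun (z : (Fin (dT + dT + 1) → ℤ) → ℝ) => bs.equivFun.symm fun b => z ((e b : ↥Λ) : Fin (dT + dT + 1) → ℤ) :=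
    hsym.comp (measurable_restrictAlong e)
  have hqmp : Measure.QuasiMeasurePreserving (fun (z : (Fin (dT + dT + 1) → ℤ) → ℝ) => bs.equivFun.symm fun b => z ((e b : ↥Λ) : Fin (dT + dT + 1) → ℤ))
      (gaussianFieldOfKernel fun x y => if hxy : x ∈ Λ ∧ y ∈ Λ then
        ((Matrix.reindex e e (LinearMap.toMatrix₂ bs bs Δ))⁻¹ : Matrix ↥Λ ↥Λ ℝ) ⟨x, hxy.1⟩ ⟨y, hxy.2⟩ else 0) (gaussMeasure μS Δ) :=
    ⟨hq, by rw [hgm]⟩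
  -- the (3.24) pair of seat n08-b's capstone, for the pulled-back ball product, in [B10] currencies
  obtain ⟨hpos, habs⟩ := hpair π hπ s (Jw h U) (aw h U) (hJΛ h U) (hA h U)
  have hballm : MeasurableSet ((fun (z : (Fin (dT + dT + 1) → ℤ) → ℝ) => bs.equivFun.symm fun b => z ((e b : ↥Λ) : Fin (dT + dT + 1) → ℤ)) ⁻¹'
      {A : Sp | ∀ c₀ : B, Real.sqrt (∑ b ∈ Finset.univ.filter (fun b => π b = c₀), bs.equivFun A b ^ 2) ≤ B10.pFun b₀ p₀ (S.gk k)}) := by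
    rw [preimage_ballBox_eq]
    exact (measurableSet_ballProduct π _).preimage (measurable_restrictAlong e)
  rw [integral_indicator hballm] at hpos habs
  have h1 : Eq324 (∫ z in (fun (z : (Fin (dT + dT + 1) → ℤ) → ℝ) => bs.equivFun.symm fun b => z ((e b : ↥Λ) : Fin (dT + dT + 1) → ℤ)) ⁻¹'
          {A : Sp | ∀ c₀ : B, Real.sqrt (∑ b ∈ Finset.univ.filter (fun b => π b = c₀), bs.equivFun A b ^ 2) ≤ B10.pFun b₀ p₀ (S.gk k)},
        Real.exp (hamiltonian s D ϰ (aw h U) (Jw h U) z) ∂gaussianFieldOfKernel fun x y => if hxy : x ∈ Λ ∧ y ∈ Λ then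
          ((Matrix.reindex e e (LinearMap.toMatrix₂ bs bs Δ))⁻¹ : Matrix ↥Λ ↥Λ ℝ) ⟨x, hxy.1⟩ ⟨y, hxy.2⟩ else 0)
      (fun n' => truncatedExp (gaussianFieldOfKernel fun x y => if hxy : x ∈ Λ ∧ y ∈ Λ then
          ((Matrix.reindex e e (LinearMap.toMatrix₂ bs bs Δ))⁻¹ : Matrix ↥Λ ↥Λ ℝ) ⟨x, hxy.1⟩ ⟨y, hxy.2⟩ else 0) (hamiltonian s D ϰ (aw h U) (Jw h U)) n')
      𝔠.nbar (𝔠.Ca + 𝔠.Cc) ((L : ℝ) ^ k * S.g0sq) (3 + 𝔠.κ₀) (S.sites k) := by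
    have h0 : Eq324 (∫ z in (fun (z : (Fin (dT + dT + 1) → ℤ) → ℝ) => bs.equivFun.symm fun b => z ((e b : ↥Λ) : Fin (dT + dT + 1) → ℤ)) ⁻¹'
          {A : Sp | ∀ c₀ : B, Real.sqrt (∑ b ∈ Finset.univ.filter (fun b => π b = c₀), bs.equivFun A b ^ 2) ≤ B10.pFun b₀ p₀ (S.gk k)},
        Real.exp (hamiltonian s D ϰ (aw h U) (Jw h U) z) ∂gaussianFieldOfKernel fun x y => if hxy : x ∈ Λ ∧ y ∈ Λ then
          ((Matrix.reindex e e (LinearMap.toMatrix₂ bs bs Δ))⁻¹ : Matrix ↥Λ ↥Λ ℝ) ⟨x, hxy.1⟩ ⟨y, hxy.2⟩ else 0)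
      (fun n' => truncatedExp (gaussianFieldOfKernel fun x y => if hxy : x ∈ Λ ∧ y ∈ Λ then
          ((Matrix.reindex e e (LinearMap.toMatrix₂ bs bs Δ))⁻¹ : Matrix ↥Λ ↥Λ ℝ) ⟨x, hxy.1⟩ ⟨y, hxy.2⟩ else 0) (hamiltonian s D ϰ (aw h U) (Jw h U)) n')
      𝔠.nbar C (S.gk k) (6 + 2 * 𝔠.κ₀) Λ.card := by
      rw [eq324_iff_abs_log_sub_le hpos]
      simpa only [cumulantSum] using habs
    refine eq324_mono h0 ?_
    rw [gk_rpow_six_add]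
    have hΛv : (Λ.card : ℝ) ≤ v * S.sites k := by
      have : (Λ.card : ℝ) = Fintype.card β := by rw [← Fintype.card_coe]; exact_mod_cast (Fintype.card_congr e).symm
      rw [this]; exact hβv
    exact budget_le_vol hC (mul_pos (pow_pos (L_pos S) k) (g0sq_pos S)) (sites_nonneg S k) hΛv hCv
  -- transport to the block along `Ψ ∘ (z ↦ bs.equivFun.symm (z ∘ e))`
  have hbox' : (fun z => Ψ h U (bs.equivFun.symm fun b => z ((e b : ↥Λ) : Fin (dT + dT + 1) → ℤ))) ⁻¹' (𝔖 k).box h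
      =ᵐ[gaussianFieldOfKernel fun x y => if hxy : x ∈ Λ ∧ y ∈ Λ then
          ((Matrix.reindex e e (LinearMap.toMatrix₂ bs bs Δ))⁻¹ : Matrix ↥Λ ↥Λ ℝ) ⟨x, hxy.1⟩ ⟨y, hxy.2⟩ else 0]
      (fun (z : (Fin (dT + dT + 1) → ℤ) → ℝ) => bs.equivFun.symm fun b => z ((e b : ↥Λ) : Fin (dT + dT + 1) → ℤ)) ⁻¹'
          {A : Sp | ∀ c₀ : B, Real.sqrt (∑ b ∈ Finset.univ.filter (fun b => π b = c₀), bs.equivFun A b ^ 2) ≤ B10.pFun b₀ p₀ (S.gk k)} := by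
    have h2 := hqmp.preimage_ae_eq (hbox h U)
    rw [← Set.preimage_comp] at h2
    exact h2
  have hV' := ae_eq_comp (g := fun A => (𝔖 k).𝒱 h U (Ψ h U A)) (g' := H h U) hq.aemeasurable
    (μ := gaussianFieldOfKernel fun x y => if hxy : x ∈ Λ ∧ y ∈ Λ then
      ((Matrix.reindex e e (LinearMap.toMatrix₂ bs bs Δ))⁻¹ : Matrix ↥Λ ↥Λ ℝ) ⟨x, hxy.1⟩ ⟨y, hxy.2⟩ else 0)
    (by rw [← hgm]; exact hV h U)
  refine eq324_box_of_presentation_ae _ ((hΨ h U).comp hq) ?_ (hboxm h) (hVm h U) hbox'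
    (hV'.trans (Filter.EventuallyEq.of_eq (funext fun z => hH h U z))) h1
  rw [hμ h U, hgm, Measure.map_map (hΨ h U) hq]

end Summit.QuantumFields.YangMills.Theorems.BalabanUVNodesN08AlphaEq324RowClassSocketEndBallCutoff

end
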